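import Summits.QuantumFields.YangMills.Theorems.DressedRitz.Negative.CentreSecondOrder
import HarnessLib

/-!
# Route `LuscherReduction`, item `DressedRitz` (stmt-QuantumFields-20205), line «polyakovlift» — NEGATIVE ∕ LOCATED FACT, part 2
# (standing crux disprover ym-cdisprove-20205-1, g13): the PAIR CENTRE at SECOND order, in the currency of the LEAD's `PolyakovLift.pair_centre` (p589839)

`PolyakovLift.pair_centre` (inputs: doors `e^{−15δ}X ≤ y^L ≤ X`, `e^{−15δ}X′ ≤ y′^L ≤ X′`, mismatch `|X − X′| ≤ ηX′`, `|X′ − X| ≤ ηX`) bounds the distance of the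
cross door's centre `X₀ = ((y+y′)/2)^L` from the block clause (B6)'s centre `M̄ = (X+X′)/2` at FIRST order, `|X₀ − M̄| ≤ (η+15δ)(2Θ₁)X₀`; in `PolyakovLift.o6_numeric`
this is the term `(η+15δ)(2Θ₁)X₀·(s·q)` of `R1`, the ONLY place where statics (o2) (`|⟨u,u′⟩| ≤ s‖u‖‖u′‖`) enters the block route to (o6) (`o6_clause`,
`dynamicCoreClauses_of_block`, p590073).

LOCATED FACT (`pair_centre_secondOrder`, same inputs, no `Θ₁`, no top): `X₀ ≤ M̄ ≤ exp(15δ + (η+15δ)²/8)·X₀`, hence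
`|X₀ − M̄| ≤ (exp(15δ + (η+15δ)²/8) − 1)·X₀ ≤ (30δ + (η+15δ)²/4)·X₀` (`η ≤ 1`, `δ ≤ 1/32`): the centre mismatch is SECOND order in the level mismatch `η`, so with
`|⟨u,u′⟩| ≤ ‖u‖‖u′‖` (Cauchy–Schwarz, `s := 1`) the `R1` term is `O(δ + η²)·X₀·q = O(λ²)·X₀·q` at `δ = Cλ³`, `η = O_k(λ)` — the block route to (o6), and with it
`LiftPositionForL P ⟸ BlockPositionForL P ∧ BlockLeakageForL P`, needs NO `StaticsForL P` input.  Mechanism (`half_pow_add_pow_le_cosh_mul_centre`): for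
`y^L ≤ e^{t}y′^L`, `y′^L ≤ e^{t}y^L` one has `(y^L + y′^L)/2 ≤ cosh(t/2)·(√(yy′))^L ≤ e^{t²/8}·((y+y′)/2)^L` (the identity `(a+a′)² − aa′(e^{t}+2+e^{−t}) =
(a − e^{t}a′)(a − e^{−t}a′) ≤ 0`, AM–GM, `cosh x ≤ e^{x²/2}`), with `t = η + 15δ` from the doors and the mismatch.

Pure real lemmas; they refute nothing and close no stub.  HONEST FRAMING: bookkeeping for the CONDITIONAL femto rung R2b1 (crux `DressedRitz` of route
`LuscherReduction`); nothing here bears on infinite volume, the continuum limit or the Clay mass gap.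
References: M. Lüscher, U. Wolff, NPB 339 (1990) 222 [cite: LuscherWolff1990]; M. Lüscher, NPB 219 (1983) 233 [cite: Luscher1983, §3].
-/

set_option autoImplicit false

noncomputable section

namespace Summit.QuantumFields.YangMills.Theorems.FemtoTransferGap.PolyakovLift.Negative

open Real

/-- Two-sided ratio control of two powers gives a `cosh` bound on their mean against the power of the mean:
`y^L ≤ e^{t}y′^L`, `y′^L ≤ e^{t}y^L` ⇒ `(y^L + y′^L)/2 ≤ exp(t²/8)·((y+y′)/2)^L`. [folklore] -/
theorem half_pow_add_pow_le_cosh_mul_centre {y y' t : ℝ} {L : ℕ} (hy : 0 < y) (hy' : 0 < y')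
    (h : y ^ L ≤ Real.exp t * y' ^ L) (h' : y' ^ L ≤ Real.exp t * y ^ L) :
    (y ^ L + y' ^ L) / 2 ≤ Real.cosh (t / 2) * ((y + y') / 2) ^ L ∧
      (y ^ L + y' ^ L) / 2 ≤ Real.exp (t ^ 2 / 8) * ((y + y') / 2) ^ L := by
  set a := y ^ L with ha_def
  set a' := y' ^ L with ha'_def
  set X0 := ((y + y') / 2) ^ L with hX0_def
  have ha : 0 < a := pow_pos hy L
  have ha' : 0 < a' := pow_pos hy' L
  have hX0 : 0 < X0 := pow_pos (by linarith) L
  set R := Real.exp (t / 2) with hR_def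
  have hR : 0 < R := Real.exp_pos _
  have hR2 : R ^ 2 = Real.exp t := by rw [hR_def, sq, ← Real.exp_add]; ring_nf
  have hRi2 : R⁻¹ ^ 2 = Real.exp (-t) := by
    rw [inv_pow, hR2, Real.exp_neg]
  have hcosh : Real.cosh (t / 2) = (R + R⁻¹) / 2 := by
    rw [Real.cosh_eq, hR_def, Real.exp_neg]
  have hc1 : 1 ≤ Real.cosh (t / 2) := Real.one_le_cosh _
  -- the key quadratic inequality `(a + a')² ≤ a a' (R + R⁻¹)²`
  have e1 : 0 ≤ Real.exp t * a' - a := sub_nonneg.2 h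
  have e2 : 0 ≤ a - Real.exp (-t) * a' := by
    rw [sub_nonneg, Real.exp_neg, inv_mul_le_iff₀ (Real.exp_pos t)]; exact h'
  have hprod := mul_nonneg e1 e2
  have key : (a + a') ^ 2 ≤ a * a' * (R + R⁻¹) ^ 2 := by
    have hexp : (R + R⁻¹) ^ 2 = Real.exp t + 2 + Real.exp (-t) := by
      have : (R + R⁻¹) ^ 2 = R ^ 2 + 2 * (R * R⁻¹) + R⁻¹ ^ 2 := by ring
      rw [this, hR2, hRi2, mul_inv_cancel₀ hR.ne']; ring
    rw [hexp]
    have hee : Real.exp t * Real.exp (-t) = 1 := by rw [← Real.exp_add, add_neg_cancel, Real.exp_zero]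
    have hexpand : (Real.exp t * a' - a) * (a - Real.exp (-t) * a') =
        Real.exp t * (a * a') + Real.exp (-t) * (a * a') - a ^ 2 - (Real.exp t * Real.exp (-t)) * a' ^ 2 := by ring
    rw [hexpand, hee, one_mul] at hprod
    nlinarith [hprod]
  -- AM–GM for the geometric term: `a a' = (y y')^L ≤ X0²`
  have hgm : a * a' ≤ X0 ^ 2 := by
    have h1 : y * y' ≤ ((y + y') / 2) ^ 2 := by nlinarith [sq_nonneg (y - y')]
    calc a * a' = (y * y') ^ L := by rw [ha_def, ha'_def, mul_pow]
      _ ≤ (((y + y') / 2) ^ 2) ^ L := pow_le_pow_left₀ (by positivity) h1 L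
      _ = X0 ^ 2 := by rw [hX0_def, ← pow_mul, ← pow_mul, mul_comm]
  -- conclude by comparing squares
  have hsq : ((a + a') / 2) ^ 2 ≤ (Real.cosh (t / 2) * X0) ^ 2 := by
    rw [hcosh]
    have : ((R + R⁻¹) / 2 * X0) ^ 2 = (R + R⁻¹) ^ 2 * X0 ^ 2 / 4 := by ring
    rw [this]
    have hRR : 0 ≤ (R + R⁻¹) ^ 2 := sq_nonneg _
    nlinarith [key, hgm, mul_le_mul_of_nonneg_left hgm hRR]
  have hfirst : (a + a') / 2 ≤ Real.cosh (t / 2) * X0 := by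
    have habs := (sq_le_sq.1 hsq)
    rwa [abs_of_nonneg (by positivity), abs_of_nonneg (by positivity)] at habs
  refine ⟨hfirst, le_trans hfirst ?_⟩
  apply mul_le_mul_of_nonneg_right _ hX0.le
  calc Real.cosh (t / 2) ≤ Real.exp ((t / 2) ^ 2 / 2) := Real.cosh_le_exp_half_sq _
    _ = Real.exp (t ^ 2 / 8) := by ring_nf

/-- For `L ≥ 1` the lower door `e^{−15δ}X ≤ y^L` with `X > 0`, `y ≥ 0` forces `y > 0` (so `pair_centre_secondOrder` applies to the LEAD's data). [folklore] -/
theorem pos_of_exp_mul_le_pow {X y c : ℝ} {L : ℕ} (hL : 1 ≤ L) (hX : 0 < X) (hy : 0 ≤ y) (h1 : Real.exp c * X ≤ y ^ L) : 0 < y := by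
  rcases hy.lt_or_eq with hpos | hzero
  · exact hpos
  · exfalso
    rw [← hzero, zero_pow (by omega)] at h1
    linarith [mul_pos (Real.exp_pos c) hX]

/-- ★ **PAIR CENTRE AT SECOND ORDER** (drop-in for the mismatch part of `PolyakovLift.pair_centre`, same inputs, no comparability∕top needed): with
`X₀ = ((y+y′)/2)^L`, `M̄ = (X+X′)/2`: `X₀ ≤ M̄ ≤ exp(15δ + (η+15δ)²/8)·X₀` and `|X₀ − M̄| ≤ (exp(15δ + (η+15δ)²/8) − 1)·X₀`. [folklore] -/
theorem pair_centre_secondOrder {X X' y y' η δ : ℝ} {L : ℕ} (hX' : 0 < X') (hy : 0 < y) (hy' : 0 < y')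
    (h1 : Real.exp (-(15 * δ)) * X ≤ y ^ L) (h2 : y ^ L ≤ X) (h1' : Real.exp (-(15 * δ)) * X' ≤ y' ^ L) (h2' : y' ^ L ≤ X')
    (hm : |X - X'| ≤ η * X') (hm' : |X' - X| ≤ η * X) :
    ((y + y') / 2) ^ L ≤ (X + X') / 2 ∧
      (X + X') / 2 ≤ Real.exp (15 * δ + (η + 15 * δ) ^ 2 / 8) * ((y + y') / 2) ^ L ∧
      |((y + y') / 2) ^ L - (X + X') / 2| ≤ (Real.exp (15 * δ + (η + 15 * δ) ^ 2 / 8) - 1) * ((y + y') / 2) ^ L := by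
  set X0 := ((y + y') / 2) ^ L with hX0_def
  have hX0 : 0 < X0 := pow_pos (by linarith) L
  have hX : 0 < X := lt_of_lt_of_le (pow_pos hy L) h2
  have hE : 0 < Real.exp (15 * δ) := Real.exp_pos _
  -- doors in the form `X ≤ e^{15δ} y^L`
  have hb : X ≤ Real.exp (15 * δ) * y ^ L := by
    have := mul_le_mul_of_nonneg_left h1 hE.le
    rwa [← mul_assoc, ← Real.exp_add, show 15 * δ + -(15 * δ) = 0 by ring, Real.exp_zero, one_mul] at this
  have hb' : X' ≤ Real.exp (15 * δ) * y' ^ L := by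
    have := mul_le_mul_of_nonneg_left h1' hE.le
    rwa [← mul_assoc, ← Real.exp_add, show 15 * δ + -(15 * δ) = 0 by ring, Real.exp_zero, one_mul] at this
  -- lower bound (power mean)
  have hlo : X0 ≤ (X + X') / 2 := by
    have := mean_pow_le_half_pow_add_pow hy.le hy'.le L
    rw [← hX0_def] at this
    linarith
  -- level mismatch in multiplicative form: `X ≤ (1+η) X' ≤ e^η X'`
  have hη0 : 0 ≤ η := by
    have := le_trans (abs_nonneg _) hm
    nlinarith
  have hXX' : X ≤ Real.exp η * X' := by
    have h := (abs_le.1 hm).2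
    nlinarith [Real.add_one_le_exp η, hX']
  have hX'X : X' ≤ Real.exp η * X := by
    have h := (abs_le.1 hm').2
    nlinarith [Real.add_one_le_exp η, hX]
  -- two-sided ratio control of the powers with `t = η + 15δ`
  have ht : Real.exp (η + 15 * δ) = Real.exp η * Real.exp (15 * δ) := Real.exp_add _ _
  have hr : y ^ L ≤ Real.exp (η + 15 * δ) * y' ^ L := by
    calc y ^ L ≤ X := h2
      _ ≤ Real.exp η * X' := hXX'
      _ ≤ Real.exp η * (Real.exp (15 * δ) * y' ^ L) := mul_le_mul_of_nonneg_left hb' (Real.exp_pos η).le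
      _ = Real.exp (η + 15 * δ) * y' ^ L := by rw [ht]; ring
  have hr' : y' ^ L ≤ Real.exp (η + 15 * δ) * y ^ L := by
    calc y' ^ L ≤ X' := h2'
      _ ≤ Real.exp η * X := hX'X
      _ ≤ Real.exp η * (Real.exp (15 * δ) * y ^ L) := mul_le_mul_of_nonneg_left hb (Real.exp_pos η).le
      _ = Real.exp (η + 15 * δ) * y ^ L := by rw [ht]; ring
  obtain ⟨-, hmean⟩ := half_pow_add_pow_le_cosh_mul_centre hy hy' hr hr'
  rw [← hX0_def] at hmean
  -- upper bound
  have hhi : (X + X') / 2 ≤ Real.exp (15 * δ + (η + 15 * δ) ^ 2 / 8) * X0 := by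
    calc (X + X') / 2 ≤ Real.exp (15 * δ) * ((y ^ L + y' ^ L) / 2) := by nlinarith [hb, hb']
      _ ≤ Real.exp (15 * δ) * (Real.exp ((η + 15 * δ) ^ 2 / 8) * X0) := mul_le_mul_of_nonneg_left hmean hE.le
      _ = Real.exp (15 * δ + (η + 15 * δ) ^ 2 / 8) * X0 := by rw [Real.exp_add]; ring
  refine ⟨hlo, hhi, ?_⟩
  rw [abs_sub_comm, abs_of_nonneg (by linarith)]
  linarith

/-- The `hmis` input of `PolyakovLift.o6_of_block` ∕ the `R1` term of `PolyakovLift.o6_numeric` WITHOUT statics: Cauchy–Schwarz (`|N| ≤ q`) and the second-order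
pair centre give `|X₀ − M̄|·|N| ≤ (exp(15δ + (η+15δ)²/8) − 1)·X₀·q`. [folklore] -/
theorem hmis_pair_secondOrder {X X' y y' η δ N q : ℝ} {L : ℕ} (hX' : 0 < X') (hy : 0 < y) (hy' : 0 < y')
    (h1 : Real.exp (-(15 * δ)) * X ≤ y ^ L) (h2 : y ^ L ≤ X) (h1' : Real.exp (-(15 * δ)) * X' ≤ y' ^ L) (h2' : y' ^ L ≤ X')
    (hm : |X - X'| ≤ η * X') (hm' : |X' - X| ≤ η * X) (hN : |N| ≤ q) :
    |((y + y') / 2) ^ L - (X + X') / 2| * |N| ≤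
      (Real.exp (15 * δ + (η + 15 * δ) ^ 2 / 8) - 1) * ((y + y') / 2) ^ L * q := by
  obtain ⟨hlo, hhi, habs⟩ := pair_centre_secondOrder hX' hy hy' h1 h2 h1' h2' hm hm'
  have hX0 : 0 < ((y + y') / 2) ^ L := pow_pos (by linarith) L
  have hfac : 0 ≤ (Real.exp (15 * δ + (η + 15 * δ) ^ 2 / 8) - 1) * ((y + y') / 2) ^ L := by
    have : X + X' ≤ X + X' := le_rfl
    nlinarith [hlo, hhi]
  exact mul_le_mul habs hN (abs_nonneg _) hfac

/-- The linearised second-order pair centre in the LEAD's parameter range (`η ≤ 1`, `δ ≤ 1/32`, so the exponent is `≤ 1` and `e^{x} − 1 ≤ 2x`):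
`|X₀ − M̄| ≤ (30δ + (η+15δ)²/4)·X₀` — the statics-free replacement of the term `(η+15δ)(2Θ₁)·s` in the budget `hC6` of `PolyakovLift.o6_numeric` is
`2·(30δ + (η+15δ)²/4)` (with `s := 1`). [folklore] -/
theorem pair_centre_secondOrder_linear {X X' y y' η δ : ℝ} {L : ℕ} (hX' : 0 < X') (hy : 0 < y) (hy' : 0 < y') (hδ0 : 0 ≤ δ)
    (hδ : δ ≤ 1 / 32) (hη1 : η ≤ 1)
    (h1 : Real.exp (-(15 * δ)) * X ≤ y ^ L) (h2 : y ^ L ≤ X) (h1' : Real.exp (-(15 * δ)) * X' ≤ y' ^ L) (h2' : y' ^ L ≤ X')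
    (hm : |X - X'| ≤ η * X') (hm' : |X' - X| ≤ η * X) :
    |((y + y') / 2) ^ L - (X + X') / 2| ≤ (30 * δ + (η + 15 * δ) ^ 2 / 4) * ((y + y') / 2) ^ L := by
  obtain ⟨-, -, habs⟩ := pair_centre_secondOrder hX' hy hy' h1 h2 h1' h2' hm hm'
  have hX0 : 0 < ((y + y') / 2) ^ L := pow_pos (by linarith) L
  have hη0 : 0 ≤ η := by
    have := le_trans (abs_nonneg _) hm
    nlinarith
  have hx0 : 0 ≤ 15 * δ + (η + 15 * δ) ^ 2 / 8 := by positivity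
  have hs0 : 0 ≤ η + 15 * δ := by linarith
  have hs1 : η + 15 * δ ≤ 3 / 2 := by linarith
  have hsq : (η + 15 * δ) ^ 2 ≤ 3 / 2 * (η + 15 * δ) := by nlinarith
  have hx1 : 15 * δ + (η + 15 * δ) ^ 2 / 8 ≤ 1 := by nlinarith
  -- `e^{x} − 1 ≤ 2x` on `[0,1]` (convexity of `exp` between `0` and `1`, `e ≤ 3`); cf. `SquarefreeSums.exp_sub_one_le_two_mul` in Literature
  have hlin : Real.exp (15 * δ + (η + 15 * δ) ^ 2 / 8) - 1 ≤ 2 * (15 * δ + (η + 15 * δ) ^ 2 / 8) := by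
    set x := 15 * δ + (η + 15 * δ) ^ 2 / 8 with hx_def
    have hconv := (convexOn_exp).2 (Set.mem_univ (0 : ℝ)) (Set.mem_univ (1 : ℝ)) (by linarith : (0 : ℝ) ≤ 1 - x) hx0
      (by ring : (1 - x) + x = 1)
    simp only [smul_eq_mul, mul_zero, mul_one, zero_add, Real.exp_zero] at hconv
    have he : Real.exp 1 ≤ 3 := by
      have := Real.exp_one_lt_d9
      linarith
    nlinarith [hconv, he]
  calc |((y + y') / 2) ^ L - (X + X') / 2| ≤ (Real.exp (15 * δ + (η + 15 * δ) ^ 2 / 8) - 1) * ((y + y') / 2) ^ L := habs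
    _ ≤ (2 * (15 * δ + (η + 15 * δ) ^ 2 / 8)) * ((y + y') / 2) ^ L := mul_le_mul_of_nonneg_right hlin hX0.le
    _ = (30 * δ + (η + 15 * δ) ^ 2 / 4) * ((y + y') / 2) ^ L := by ring

end Summit.QuantumFields.YangMills.Theorems.FemtoTransferGap.PolyakovLift.Negative

end
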